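import Summits.QuantumFields.YangMills.Theorems.HypercubicLimit.Negative.OneFieldReduction
import HarnessLib

/-!
# `CriticalContinuumLimit` — line `Sketch`: one OS scalar field extended by zero to all species is
# Yang–Mills OS data along the silenced scheme (stub `stub_oneFieldExtension`)

Support file for crux `stmt-QuantumFields-8762`
(`Summit.QuantumFields.YangMills.Theses.EquipartitionCriticality.CriticalContinuumLimit`): this is stub
`stub_oneFieldExtension` of line `Sketch` (skeleton `Cruxes/CriticalContinuumLimit/Lines/Sketch.lean`).

What (pure bookkeeping; tree `extendByZero`, `onlySpecies`).  Let `S₁` be ONE Schwinger family on `ℝ⁴`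
(the renormalised curvature field) with the OS axioms E0', E0–E4 (`OSAxiomsSchwinger S₁.toLabelled`,
full `SO(4)` invariance), towards which the lattice curvature `n`-point functions converge along the
species scheme `sch`, and which is non-trivial, non-Gaussian and has `HasMassGap Δ`.  Then the labelled
family `extendByZero r.curvature S₁` (equal to `S₁` on the constant label strings `F ⋯ F` and `0` on every
other string) is `OSData` over ALL species `YMSpecies G`; it IS Yang–Mills (`IsYangMillsFor`) along the
scheme `onlySpecies sch r.curvature` which renormalises every species other than the curvature to `0`
(so that every lattice `n`-point function with a foreign species in the string vanishes identically,
`latticeSchwinger_onlySpecies_of_ne`, while the curvature strings are untouched,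
`latticeSchwinger_onlySpecies_self`); and it has the same non-triviality, non-Gaussianity and mass gap,
all three being read on constant curvature strings (`extendByZero_const`) or transferred by
`hasMassGap_extendByZero`.

Proof outline.  The tree (`Theorems/HypercubicLimit/Negative/ExtendByZero.lean`) transfers E0, E0', E2,
E3, E4 and `HasMassGap` from `S₁` to `extendByZero c₀ S₁`; the one missing axiom, full E1
(`isEuclideanInvariant_extendByZero`: translations AND all determinant-one linear isometries), is proved
the same way — on a constant string it is `S₁`'s invariance, on any other string both sides are `0`.
`osAxiomsSchwinger_extendByZero` bundles the seven axioms, `OSData.ofAxioms` packages them, and the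
convergence / non-triviality / non-Gaussianity clauses follow the model `clauses_of_clauses₁` of
`Negative/OneFieldReduction.lean`.
-/

noncomputable section

open scoped SchwartzMap
open MeasureTheory Filter Topology
open Literature.MathematicalPhysics.AQFT Literature.MathematicalPhysics.QuantumLattice
open Literature.MathematicalPhysics.QuantumFieldTheory
open Summit.QuantumFields.YangMills.Theorems.HypercubicLimit.Negative (onlySpecies extendByZero)

namespace Summit.QuantumFields.YangMills.Theorems.CriticalContinuumLimit

variable {G : Type} [Group G] [TopologicalSpace G] [IsTopologicalGroup G] [CompactSpace G]
  [MeasurableSpace G] [BorelSpace G]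

section ExtendByZeroAxioms

open Summit.QuantumFields.YangMills.Theorems.HypercubicLimit.Negative

variable {ι : Type} {c₀ : ι} {S₁ : SchwingerFamily (EuclideanSpace ℝ (Fin 4))}

/-- **E1 for the extension by zero**: full Euclidean invariance (translations and all
determinant-one linear isometries, on `⁰𝒮`) passes from the one-field family `S₁` to
`extendByZero c₀ S₁` — on a constant label string it is `S₁`'s invariance, on every other string both
sides vanish. [folklore] -/
theorem isEuclideanInvariant_extendByZero (h : S₁.toLabelled.IsEuclideanInvariant) :
    (extendByZero c₀ S₁).IsEuclideanInvariant := by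
  refine ⟨fun n k a F hF => ?_, fun n k R hR F hF => ?_⟩
  · by_cases hk : ∀ i, k i = c₀
    · rw [extendByZero_of_all c₀ S₁ hk]; exact h.1 n (fun _ => ()) a F hF
    · rw [extendByZero_of_not_all c₀ S₁ hk]; rfl
  · by_cases hk : ∀ i, k i = c₀
    · rw [extendByZero_of_all c₀ S₁ hk]; exact h.2 n (fun _ => ()) R hR F hF
    · rw [extendByZero_of_not_all c₀ S₁ hk]; rfl

/-- **The OS axioms (E0', E0–E4) pass to the extension by zero** of a one-field OS family.
[folklore] -/
theorem osAxiomsSchwinger_extendByZero (h : OSAxiomsSchwinger S₁.toLabelled) :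
    OSAxiomsSchwinger (extendByZero c₀ S₁) where
  normalized := isNormalized_extendByZero h.normalized
  hermitian := isHermitian_extendByZero h.hermitian
  invariant := isEuclideanInvariant_extendByZero h.invariant
  reflectionPositive := isReflectionPositive_extendByZero h.reflectionPositive
  symmetric := isSymmetric_extendByZero h.symmetric
  cluster := hasClusterProperty_extendByZero h.cluster
  linearGrowth := hasLinearGrowth_extendByZero h.linearGrowth

end ExtendByZeroAxioms

/-- **stub_oneFieldExtension** (bookkeeping; tree `extendByZero`/`onlySpecies`): one OS scalar field
`S₁` for the renormalised curvature along `sch` — OS axioms E0', E0–E4 (full `SO(4)`), convergence of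
the curvature strings, one-field non-triviality, non-Gaussianity and `HasMassGap Δ` — extends by zero
to OS data over ALL species which ARE Yang–Mills along `onlySpecies sch r.curvature` (every other
species renormalised to `0`), with the same three clauses on the curvature.  The witness is
`OSData.ofAxioms (extendByZero r.curvature S₁) _`. [folklore] -/
theorem stub_oneFieldExtension (r : LatticeRep G) (sch : SpeciesScheme (YMSpecies G))
    (S₁ : SchwingerFamily (EuclideanSpace ℝ (Fin 4))) (Δ : ℝ) (hOS : OSAxiomsSchwinger S₁.toLabelled)
    (hconv : ∀ (n : ℕ), n ≠ 0 → ∀ (f : Fin n → 𝓢(EuclideanSpace ℝ (Fin 4), ℝ))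
      (F : 𝓢((Fin n → EuclideanSpace ℝ (Fin 4)), ℂ)),
      IsTensorOf F (fun i => ofRealTest (f i)) → IsOffDiagonal F →
        Tendsto (fun k : ℕ =>
          ((latticeSchwinger r.ρ sch (fun s => s.F) k n (fun _ => r.curvature) f : ℝ) : ℂ))
          atTop (𝓝 (S₁ n F)))
    (hnt : ∃ (F₁ G₁ : 𝓢((Fin 1 → EuclideanSpace ℝ (Fin 4)), ℂ))
      (H₁ : 𝓢((Fin (1 + 1) → EuclideanSpace ℝ (Fin 4)), ℂ)),
      IsTimeOrdered F₁ ∧ IsTimeOrdered G₁ ∧ IsAppendTensorOf H₁ (osAdjoint F₁) G₁ ∧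
        S₁ (1 + 1) H₁ ≠ S₁ 1 (osAdjoint F₁) * S₁ 1 G₁)
    (hng : ∃ (f g h : 𝓢(EuclideanSpace ℝ (Fin 4), ℂ)) (Ffgh : 𝓢((Fin 3 → EuclideanSpace ℝ (Fin 4)), ℂ))
      (Fgh Ffh Ffg : 𝓢((Fin 2 → EuclideanSpace ℝ (Fin 4)), ℂ))
      (Ff Fg Fh : 𝓢((Fin 1 → EuclideanSpace ℝ (Fin 4)), ℂ)),
      IsTensorOf Ffgh ![f, g, h] ∧ IsOffDiagonal Ffgh ∧ IsTensorOf Fgh ![g, h] ∧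
      IsTensorOf Ffh ![f, h] ∧ IsTensorOf Ffg ![f, g] ∧ IsTensorOf Ff ![f] ∧ IsTensorOf Fg ![g] ∧
      IsTensorOf Fh ![h] ∧
        S₁ 3 Ffgh - S₁ 1 Ff * S₁ 2 Fgh - S₁ 1 Fg * S₁ 2 Ffh - S₁ 1 Fh * S₁ 2 Ffg +
          2 * (S₁ 1 Ff * S₁ 1 Fg * S₁ 1 Fh) ≠ 0)
    (hgap : S₁.toLabelled.HasMassGap Δ) :
    ∃ T : OSData (YMSpecies G) 4,
      IsYangMillsFor r (onlySpecies sch r.curvature) T ∧ T.IsNontrivial r.curvature ∧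
        T.IsNonGaussian r.curvature ∧ T.HasMassGap Δ := by
  refine ⟨OSData.ofAxioms (extendByZero r.curvature S₁) (osAxiomsSchwinger_extendByZero hOS),
    ?_, ?_, ?_, ?_⟩
  · -- joint convergence along the silenced scheme
    intro n hn σ f F hF hod
    rw [OSData.ofAxioms_schwinger]
    by_cases hσ : ∀ i, σ i = r.curvature
    · obtain rfl : σ = fun _ => r.curvature := funext hσ
      rw [HypercubicLimit.Negative.extendByZero_const]
      simp_rw [HypercubicLimit.Negative.latticeSchwinger_onlySpecies_self]
      exact hconv n hn f F hF hod
    · obtain ⟨i₀, hi₀⟩ := not_forall.mp hσ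
      rw [HypercubicLimit.Negative.extendByZero_of_not_all _ _ (fun hall => hi₀ (hall i₀))]
      simp_rw [HypercubicLimit.Negative.latticeSchwinger_onlySpecies_of_ne r sch r.curvature _ n σ f
        hi₀]
      simp
  · -- non-triviality of the curvature, read on the constant curvature strings
    unfold OSData.IsNontrivial
    simpa using hnt
  · -- non-Gaussianity of the curvature, read on the constant curvature strings
    unfold OSData.IsNonGaussian
    simpa using hng
  · -- the full-spectrum mass gap transfers to the extension by zero
    exact HypercubicLimit.Negative.hasMassGap_extendByZero hgap

end Summit.QuantumFields.YangMills.Theorems.CriticalContinuumLimit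

end
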